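import Summits.CriticalPhenomena.SAWScalingLimit.Theorems.IsingBoundaryRatio.Negative.IsingBoundaryRatioLattice
import Literature.Probability.LatticeModels.PlanarIsingFreeTwoPointJordan
import Literature.Probability.LatticeModels.PlanarIsingTwoPointProofs
import Literature.Probability.RandomPlanarGeometry.HullSubdomainPullback

/-!
# Bulk free two-point ratio of nested Jordan domains (line `fk-anchor-transfer`, stub
`stub_bulkFreeRatio` of the crux `IsingBoundaryRatio`, stmt-CriticalPhenomena-10650)

For Dobrushin domains `D' ⊆ D`, a conformal chart `φ : ℍ → D`, the pulled-back hull
`A = closure (ℍ ∖ φ⁻¹(D'))`, a conformal equivalence `Φ : ℍ ∖ A → ℍ` and fixed interior points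
`z ≠ w` of `D'`, the nested ratio of the critical FREE Ising two-point functions of the canonical
discretisations `Ω'_δ`, `Ω_δ` (graph `discreteDomainGraph`, volume `meshDomainFinset`: all sites
of `Ω_δ` free; `T = Negative.T`),

`⟨σ_{[z/δ]}σ_{[w/δ]}⟩^free_{Ω'_δ} / ⟨σ_{[z/δ]}σ_{[w/δ]}⟩^free_{Ω_δ}
    → ⟨σ_zσ_w⟩^free_{D'} / ⟨σ_zσ_w⟩^free_{D}`  as `δ → 0⁺`,

the right-hand side written through CHI's explicit functions `twoPointFreeCHI` (Chelkak–Hongler–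
Izyurov, Ann. Math. 181 (2015), eqs. (1.2)–(1.3)) in the charts `Φ ∘ φ⁻¹ : D' → ℍ` and
`φ⁻¹ : D → ℍ`.

This is CHI Theorem 1.1 (free boundary conditions, `ϱ(δ)`-normalised) applied to `D'` and to `D`
and divided: `ϱ(δ)` cancels. CHI Theorem 1.1 for this discretisation is not proved in the tree
(`chi_twoPoint_rho_of_ratios` derives the sibling statement for the volume `meshInteriorFinset`
from CHI Prop. 2.20 / Thm. 1.7, themselves hypotheses), so it enters as the named fact
`chi_twoPoint_free_jordan` and the theorem `bulkFreeRatio_of_chi` is the conditional reduction.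
PROVED here besides the bookkeeping: the explicit free two-point function is positive at distinct
interior points (`twoPointFreeCHI_pos`: `0 < u < 1` in `ℍ`), so the quotient of the limits is an
honest limit of quotients, and `Φ ∘ φ⁻¹` is a conformal bijection `D' → ℍ`
(`ConformalEquiv.restrHull`, `ℍ ∖ A = φ⁻¹(D')`).
-/

noncomputable section

open scoped Classical Topology ComplexConjugate
open MeasureTheory Filter Set Function Metric Complex
open Literature.Probability.LatticeModels Literature.Probability.RandomPlanarGeometry
open UpperHalfPlane (upperHalfPlaneSet isOpen_upperHalfPlaneSet)
open Summit.CriticalPhenomena.SAWScalingLimit.Theorems.IsingBoundaryRatio.Negative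

namespace Summit.CriticalPhenomena.SAWScalingLimit.Theorems.IsingBoundaryRatio

/-- **CHI's explicit free two-point function is positive at distinct interior points**: for an open
`Ω`, a conformal bijection `ψ : Ω → ℍ` and `z ≠ w` in `Ω`, `0 < ⟨σ_zσ_w⟩^free_Ω = twoPointFreeCHI ψ z w`
(`⟨σσ⟩^free = ⟨σσ⟩⁺ · 𝓑` with `⟨σσ⟩⁺ > 0` and `𝓑 > 0`, i.e. `0 < u_{ψz ψw} < 1` in `ℍ` and `ψ' ≠ 0`). -/
theorem twoPointFreeCHI_pos {Ω : Set ℂ} (hΩ : IsOpen Ω) {ψ : ℂ → ℂ}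
    (hψ : IsConformalBijection ψ Ω upperHalfPlaneSet) {z w : ℂ} (hz : z ∈ Ω) (hw : w ∈ Ω)
    (hzw : z ≠ w) : 0 < twoPointFreeCHI ψ z w := by
  have hψz : 0 < (ψ z).im := hψ.2.mapsTo hz
  have hψw : 0 < (ψ w).im := hψ.2.mapsTo hw
  have hw1 : ψ w ≠ ψ z := fun h => hzw (hψ.2.injOn hz hw h.symm)
  have hw2 : ψ w ≠ conj (ψ z) := fun h => by
    have h' := congrArg Complex.im h
    rw [Complex.conj_im] at h'
    linarith
  rw [twoPointFreeCHI_eq_mul_bCHI hw1 hw2]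
  exact mul_pos (twoPointPlusCHI_pos' hΩ hψ hz hw hzw) (bCHI_pos hψ hz hw hzw)

/-- **Bulk free two-point ratio from CHI Theorem 1.1 (free).** Conditional reduction of the stub
`stub_bulkFreeRatio` (= `BulkFreeRatio` of the line `fk-anchor-transfer`) to the named fact
`chi_twoPoint_free_jordan`: for Dobrushin domains `D' ⊆ D`, a conformal chart `φ : ℍ → D`, the
pulled-back hull `A = closure (ℍ ∖ φ⁻¹(D'))`, any conformal equivalence `Φ : ℍ ∖ A → ℍ` and interior
points `z ≠ w` of `D'`, the nested lattice ratio
`⟨σ_{[z/δ]}σ_{[w/δ]}⟩^free_{Ω'_δ} / ⟨σ_{[z/δ]}σ_{[w/δ]}⟩^free_{Ω_δ}` tends to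
`⟨σ_zσ_w⟩^free_{D'} / ⟨σ_zσ_w⟩^free_D` written through the charts `Φ ∘ φ⁻¹ : D' → ℍ` (a conformal
bijection since `ℍ ∖ A = φ⁻¹(D')`, `ConformalEquiv.restrHull`) and `φ⁻¹ : D → ℍ`. Proof: CHI Thm 1.1
for `D'` and for `D` (both Jordan), divided — `ϱ(δ) > 0` cancels for every `δ` and the denominator
limit is positive (`twoPointFreeCHI_pos`). -/
theorem bulkFreeRatio_of_chi :
    Literature.Probability.LatticeModels.chi_twoPoint_free_jordan →
    ∀ (D D' : DobrushinDomain), D'.carrier ⊆ D.carrier →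
      ∀ (φ : ConformalEquiv UpperHalfPlane.upperHalfPlaneSet D.carrier) (A : Set ℂ),
        A = closure (UpperHalfPlane.upperHalfPlaneSet \
          {z | z ∈ UpperHalfPlane.upperHalfPlaneSet ∧ φ z ∈ D'.carrier}) →
      ∀ (Φ : ConformalEquiv (UpperHalfPlane.upperHalfPlaneSet \ A) UpperHalfPlane.upperHalfPlaneSet)
        (z w : ℂ), z ∈ D'.carrier → w ∈ D'.carrier → z ≠ w →
        Tendsto (fun δ => T D'.carrier δ (nearestSite δ z) (nearestSite δ w) /
            T D.carrier δ (nearestSite δ z) (nearestSite δ w)) (𝓝[>] 0)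
          (𝓝 (twoPointFreeCHI (fun x => Φ (φ.symm x)) z w /
            twoPointFreeCHI (fun x => φ.symm x) z w)) := by
  intro hchi D D' hsub φ A hA Φ z w hz hw hzw
  -- `A` is the pulled-back hull `φ.pullbackHull D'` (definitionally)
  obtain rfl : A = φ.pullbackHull D' := hA
  -- the composite chart `Φ ∘ φ⁻¹ : D' → ℍ` as a conformal equivalence (`ℍ ∖ A = φ⁻¹(D')`)
  obtain ⟨χ, hχ⟩ : ∃ χ : ConformalEquiv D'.carrier upperHalfPlaneSet, ∀ x, χ x = Φ (φ.symm x) :=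
    ⟨(φ.restrHull D' hsub).symm.trans Φ, fun _ => rfl⟩
  have hfun : (fun x => Φ (φ.symm x)) = fun x => χ x := funext fun x => (hχ x).symm
  rw [hfun]
  have hψ : IsConformalBijection (fun x => φ.symm x) D.carrier upperHalfPlaneSet :=
    ⟨φ.symm.differentiableOn_coe, φ.symm.bijOn⟩
  have hψ' : IsConformalBijection (fun x => χ x) D'.carrier upperHalfPlaneSet :=
    ⟨χ.differentiableOn_coe, χ.bijOn⟩
  -- CHI Thm 1.1 (free) for `D'` and for `D`
  have hN := hchi D'.toJordanDomain (fun x => χ x) hψ' z hz w hw hzw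
  have hM := hchi D.toJordanDomain (fun x => φ.symm x) hψ z (hsub hz) w (hsub hw) hzw
  have hpos : 0 < twoPointFreeCHI (fun x => φ.symm x) z w :=
    twoPointFreeCHI_pos D.isOpen hψ (hsub hz) (hsub hw) hzw
  -- divide: `ϱ(δ)` cancels for every `δ`
  refine (hN.div hM hpos.ne').congr fun δ => ?_
  rw [Pi.div_apply]
  exact div_div_div_cancel_right₀ (rhoCHI_pos δ).ne' _ _

end Summit.CriticalPhenomena.SAWScalingLimit.Theorems.IsingBoundaryRatio
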